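import Summits.Ventures.LatticeQCDFlow.Scoring.SU2CharacterRowIntegral
import Summits.Ventures.LatticeQCDFlow.Scoring.TorusRowDecomposition
import HarnessLib

/-!
# SU(2) on the 2-torus `(ℤ/L)²`: the Haar integral of a product of plaquette characters is `[x ≡ n]·(n+1)^{−L²}`

HONEST FRAMING: exact (Metropolis-corrected) sampling algorithms for lattice gauge theory;
figures of merit are autocorrelation/cost numbers at stated couplings and volumes; no
continuum-physics claim.

Venture `LatticeQCDFlow` (cell pub-lqcd), sub-topic `Scoring`; FANOUT row 5 (`s0-sun-a`), GEN-10.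
NEW WORK of the cell (placement rule); step 6b of row 5's route to the exact SU(2) torus formula —
THE LATTICE ASSEMBLY.  For theory-2's lattice `(ℤ/L)²` (`L ≥ 1`), the characters `χ_n = U_n(a₀)` of
`SU(2)` and any assignment `m : Λ → ℕ` of representations to the plaquettes (= sites in `d = 2`):

* `integral_rowProd_su2Character_mul` — the ordered product `r_0 r_1 ⋯ r_{L−1}` of independent Haar
  links is Haar distributed: `∫ χ_p(r_0⋯r_{L−1}) χ_q(r_0⋯r_{L−1}) dHaar^{⊗(ℤ/L)}(r) = [p = q]`;
* `integral_v_prod_su2Character` — integrating the VERTICAL links row by row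
  (`TorusRowDecomposition.integral_prod_rows` + `SU2CharacterRowIntegral.integral_row_su2Character`):
  each row `j` with constant representation `n_j` leaves `χ_{n_j}(R_j) χ_{n_j}(R_{j+1})/(n_j+1)^L`,
  `R_j` the row holonomy (Polyakov line) of the horizontal links, and a non-constant row kills the integral;
* **`integral_prod_su2Character_plaquettes`** — THE RESULT: under product Haar measure on the links,
  `∫ ∏_{x ∈ Λ} χ_{m_x}(U_x) dHaar^{⊗E} = [∀ x, m_x = m_0]·((m_0+1)^{L²})⁻¹`
  (the horizontal links integrate by orthonormality of the characters of the row holonomies, forcing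
  `n_j = n_{j−1}` around the torus).  This is the `d = 2` evaluation left open in
  `Scoring/SU2LatticeCharacterExpansion.lean`; with it the character expansion of the Wilson partition
  function collapses to `Z_{(ℤ/L)²}^{SU(2)}(β) = Σ_n (c_n(β)/(n+1))^{L²}` (next file).

Elementary given the row integral; nothing is cited; no `def`.
-/

noncomputable section

open Real MeasureTheory Set Function Finset Polynomial.Chebyshev
open Literature.MathematicalPhysics.QuantumFieldTheory Literature.MathematicalPhysics.QuantumLattice
open Summit.Ventures.LatticeQCDFlow.Exactness

namespace Summit.Ventures.LatticeQCDFlow.Scoring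

variable {L : ℕ} [NeZero L]

/-! ## §1. The row holonomy of independent Haar links is Haar distributed -/

/-- **Orthonormality of the characters of a row holonomy**: for independent Haar links
`r : ℤ/L → SU(2)`, `∫ χ_p(r_0 r_1 ⋯ r_{L−1})·χ_q(r_0 r_1 ⋯ r_{L−1}) dHaar^{⊗(ℤ/L)}(r) = [p = q]`
(the ordered product `r_0 · (r_1⋯r_{L−1})` is Haar distributed by right invariance in `r_0`). -/
theorem integral_rowProd_su2Character_mul (p q : ℕ) :
    ∫ r, (U ℝ p).eval (su2a0 ((List.range L).map fun k : ℕ => r (k : ZMod L)).prod) *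
        (U ℝ q).eval (su2a0 ((List.range L).map fun k : ℕ => r (k : ZMod L)).prod)
        ∂(Measure.pi fun _ : ZMod L => haarProbability (Matrix.specialUnitaryGroup (Fin 2) ℂ)) =
      if p = q then 1 else 0 := by
  obtain ⟨L', rfl⟩ : ∃ L', L = L' + 1 := Nat.exists_eq_succ_of_ne_zero (NeZero.ne L)
  have hprod : ∀ r : ZMod (L' + 1) → Matrix.specialUnitaryGroup (Fin 2) ℂ,
      ((List.range (L' + 1)).map fun k : ℕ => r (k : ZMod (L' + 1))).prod =
        r 0 * ((List.range L').map fun k : ℕ => r ((k + 1 : ℕ) : ZMod (L' + 1))).prod := by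
    intro r
    rw [List.range_succ_eq_map, List.map_cons, List.prod_cons, List.map_map, Nat.cast_zero]
    rfl
  simp_rw [hprod]
  have hT : ∀ (r : ZMod (L' + 1) → Matrix.specialUnitaryGroup (Fin 2) ℂ)
      (g : Matrix.specialUnitaryGroup (Fin 2) ℂ),
      ((List.range L').map fun k : ℕ => update r 0 g ((k + 1 : ℕ) : ZMod (L' + 1))).prod =
        ((List.range L').map fun k : ℕ => r ((k + 1 : ℕ) : ZMod (L' + 1))).prod := by
    intro r g
    congr 1
    refine List.map_congr_left fun k hk => ?_
    rw [List.mem_range] at hk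
    rw [update_of_ne]
    rw [← Nat.cast_zero]
    exact (natCast_zmod_ne_of_lt (by omega) (by omega) (by omega)).symm
  have hcont : Continuous fun r : ZMod (L' + 1) → Matrix.specialUnitaryGroup (Fin 2) ℂ =>
      ((List.range L').map fun k : ℕ => r ((k + 1 : ℕ) : ZMod (L' + 1))).prod := by
    refine continuous_list_prod _ fun k _ => ?_
    exact continuous_apply _
  rw [integral_pi_mul_of_update_eq (haarProbability (Matrix.specialUnitaryGroup (Fin 2) ℂ)) 0
    (fun r => ((List.range L').map fun k : ℕ => r ((k + 1 : ℕ) : ZMod (L' + 1))).prod) hT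
    (fun g => (U ℝ p).eval (su2a0 g) * (U ℝ q).eval (su2a0 g))
    (integrable_pi_su2_of_continuous ((continuous_su2Character_comp p
      ((continuous_apply 0).mul hcont)).mul
      (continuous_su2Character_comp q ((continuous_apply 0).mul hcont)))),
    integral_su2Character_mul_su2Character]

/-! ## §2. Integrating the vertical links row by row -/

/-- **The vertical links, row by row.**  For horizontal links `h : Λ → SU(2)` fixed, the integral
over the vertical links `v : Λ → SU(2)` of the product of plaquette characters of the configuration
`h ⊔ v` factorises over the rows, each row giving `integral_row_su2Character`:
`∫ ∏_x χ_{m_x}(U_x(h ⊔ v)) dHaar^{⊗Λ}(v)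
   = ∏_j [∀ i, m_{(i,j)} = m_{(0,j)}]·χ_{m_{(0,j)}}(R_j(h))·χ_{m_{(0,j)}}(R_{j+1}(h))/(m_{(0,j)}+1)^L`,
`R_j(h) = h(0,j) h(1,j) ⋯ h(L−1,j)` the row holonomy. -/
theorem integral_v_prod_su2Character (m : Site 2 L → ℕ)
    (h : Site 2 L → Matrix.specialUnitaryGroup (Fin 2) ℂ) :
    ∫ v, ∏ x : Site 2 L, (U ℝ (m x)).eval (su2a0
        (plaquetteHolonomy (fun e : Edge 2 L => (![h e.1, v e.1] : Fin 2 → _) e.2) x 0 1))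
        ∂(Measure.pi fun _ : Site 2 L => haarProbability (Matrix.specialUnitaryGroup (Fin 2) ℂ)) =
      ∏ j : ZMod L, if (∀ i : ZMod L, m ![i, j] = m ![0, j]) then
        (U ℝ (m ![0, j])).eval (su2a0 ((List.range L).map fun k : ℕ => h ![(k : ZMod L), j]).prod) *
          (U ℝ (m ![0, j])).eval (su2a0 ((List.range L).map fun k : ℕ => h ![(k : ZMod L), j + 1]).prod) /
          ((m ![0, j] : ℝ) + 1) ^ L
        else 0 := by
  have hrows := integral_prod_rows (haarProbability (Matrix.specialUnitaryGroup (Fin 2) ℂ))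
    (fun (j : ZMod L) (r : ZMod L → Matrix.specialUnitaryGroup (Fin 2) ℂ) =>
      ∏ i : ZMod L, (U ℝ (m ![i, j])).eval (su2a0 (h ![i, j] * r (i + 1) * (h ![i, j + 1])⁻¹ * (r i)⁻¹)))
  beta_reduce at hrows
  have hpt : ∀ v : Site 2 L → Matrix.specialUnitaryGroup (Fin 2) ℂ,
      (∏ x : Site 2 L, (U ℝ (m x)).eval (su2a0
        (plaquetteHolonomy (fun e : Edge 2 L => (![h e.1, v e.1] : Fin 2 → _) e.2) x 0 1))) =
      ∏ j : ZMod L, ∏ i : ZMod L, (U ℝ (m ![i, j])).eval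
        (su2a0 (h ![i, j] * v ![i + 1, j] * (h ![i, j + 1])⁻¹ * (v ![i, j])⁻¹)) := by
    intro v
    rw [prod_site_two]
    refine Finset.prod_congr rfl fun j _ => Finset.prod_congr rfl fun i _ => ?_
    rw [plaquetteHolonomy_hv]
  simp_rw [hpt]
  rw [hrows]
  refine Finset.prod_congr rfl fun j _ => ?_
  exact integral_row_su2Character (fun i => h ![i, j]) (fun i => h ![i, j + 1]) (fun i => m ![i, j])

/-! ## §3. Integrating the horizontal links: orthonormality around the torus -/

/-- Going once around the torus: if `n_j = n_{j−1}` for every `j ∈ ℤ/L` then `n` is constant. -/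
theorem zmod_cyclic_const {α : Type*} {n : ZMod L → α} (hn : ∀ j, n j = n (j - 1)) (j : ZMod L) :
    n j = n 0 := by
  rw [← ZMod.natCast_zmod_val j]
  induction j.val with
  | zero => rw [Nat.cast_zero]
  | succ k ih => rw [hn, Nat.cast_succ, add_sub_cancel_right, ih]

/-- Re-indexing the second row holonomy factor around the torus:
`∏_j F_j(R_{j+1}) = ∏_j F_{j−1}(R_j)`. -/
theorem prod_zmod_shift {M : Type*} [CommMonoid M] (F : ZMod L → ZMod L → M) :
    ∏ j : ZMod L, F j (j + 1) = ∏ j : ZMod L, F (j - 1) j := by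
  refine Fintype.prod_equiv (Equiv.addRight (1 : ZMod L)) _ _ fun j => ?_
  simp only [Equiv.coe_addRight, add_sub_cancel_right]

/-- **THE HAAR INTEGRAL OF A PRODUCT OF PLAQUETTE CHARACTERS ON THE 2-TORUS.**  For `L ≥ 1`, every
assignment `m : Λ → ℕ` of `SU(2)` representations to the plaquettes of `(ℤ/L)²`, and product Haar
measure on the links:
`∫ ∏_{x ∈ Λ} χ_{m_x}(U_x) dHaar^{⊗E}(U) = [∀ x, m_x = m_0] · ((m_0 + 1)^{L²})⁻¹`
(`χ_n = U_n(a₀)` the character of the `(n+1)`-dimensional irreducible representation, `U_x` the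
plaquette holonomy at `x`): the vertical links merge each row into the characters of its two row
holonomies, and the horizontal links then integrate by orthonormality of the characters of the
(Haar distributed) row holonomies, which forces one representation on the whole torus and leaves the
weight `dim^{−#plaquettes} = (m_0+1)^{−L²}`. -/
theorem integral_prod_su2Character_plaquettes (m : Site 2 L → ℕ) :
    ∫ V, ∏ x : Site 2 L, (U ℝ (m x)).eval (su2a0 (plaquetteHolonomy V x 0 1))
        ∂(Measure.pi fun _ : Edge 2 L => haarProbability (Matrix.specialUnitaryGroup (Fin 2) ℂ)) =
      if (∀ x, m x = m 0) then ((((m 0 : ℝ) + 1) ^ (L ^ 2)))⁻¹ else 0 := by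
  -- Fubini: horizontal links outside, vertical links inside
  have hcont : Continuous fun V : GaugeConfig 2 L (Matrix.specialUnitaryGroup (Fin 2) ℂ) =>
      ∏ x : Site 2 L, (U ℝ (m x)).eval (su2a0 (plaquetteHolonomy V x 0 1)) := by
    refine continuous_finsetProd _ fun x _ => continuous_su2Character_comp (m x) ?_
    unfold plaquetteHolonomy
    fun_prop
  rw [integral_gaugeConfig_two_eq_integral_integral _ _ (integrable_pi_su2_of_continuous hcont)]
  simp_rw [integral_v_prod_su2Character m]
  -- the row representations `n_j = m(0,j)`
  by_cases hrows : ∀ j i : ZMod L, m ![i, j] = m ![0, j]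
  · simp_rw [if_pos (hrows _)]
    -- pull out the dimension weights and re-index the second holonomy factor
    have hpt : ∀ h : Site 2 L → Matrix.specialUnitaryGroup (Fin 2) ℂ,
        (∏ j : ZMod L,
          (U ℝ (m ![0, j])).eval (su2a0 ((List.range L).map fun k : ℕ => h ![(k : ZMod L), j]).prod) *
            (U ℝ (m ![0, j])).eval (su2a0 ((List.range L).map fun k : ℕ => h ![(k : ZMod L), j + 1]).prod) /
            ((m ![0, j] : ℝ) + 1) ^ L) =
        (∏ j : ZMod L, (((m ![0, j] : ℝ) + 1) ^ L)⁻¹) *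
          ∏ j : ZMod L,
            ((U ℝ (m ![0, j])).eval (su2a0 ((List.range L).map fun k : ℕ => h ![(k : ZMod L), j]).prod) *
              (U ℝ (m ![0, j - 1])).eval (su2a0 ((List.range L).map fun k : ℕ => h ![(k : ZMod L), j]).prod)) := by
      intro h
      simp only [div_eq_mul_inv]
      rw [Finset.prod_mul_distrib, mul_comm, Finset.prod_mul_distrib, Finset.prod_mul_distrib,
        prod_zmod_shift (fun a j => (U ℝ (m ![0, a])).eval
          (su2a0 ((List.range L).map fun k : ℕ => h ![(k : ZMod L), j]).prod))]
    simp_rw [hpt]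
    have hrows2 := integral_prod_rows (haarProbability (Matrix.specialUnitaryGroup (Fin 2) ℂ))
      (fun (j : ZMod L) (r : ZMod L → Matrix.specialUnitaryGroup (Fin 2) ℂ) =>
        (U ℝ (m ![0, j])).eval (su2a0 ((List.range L).map fun k : ℕ => r (k : ZMod L)).prod) *
          (U ℝ (m ![0, j - 1])).eval (su2a0 ((List.range L).map fun k : ℕ => r (k : ZMod L)).prod))
    beta_reduce at hrows2
    rw [integral_const_mul, hrows2]
    simp_rw [integral_rowProd_su2Character_mul]
    by_cases hconst : ∀ x, m x = m 0
    · -- one representation on the whole torus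
      rw [if_pos hconst]
      have h0 : ∀ j : ZMod L, m ![0, j] = m 0 := fun j => hconst _
      simp only [h0, if_true, Finset.prod_const_one, mul_one, Finset.prod_const, Finset.card_univ,
        ZMod.card]
      rw [inv_pow, ← pow_mul, sq]
    · -- the rows are constant but two adjacent rows differ: an orthogonality factor vanishes
      rw [if_neg hconst]
      have h00 : (![0, 0] : Site 2 L) = 0 := by
        funext k
        fin_cases k <;> rfl
      have hne : ∃ j : ZMod L, m ![0, j] ≠ m ![0, j - 1] := by
        by_contra hall
        push Not at hall
        apply hconst
        intro x
        have hcyc : ∀ j : ZMod L, m ![0, j] = m ![0, 0] := fun j =>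
          zmod_cyclic_const (n := fun j => m ![0, j]) hall j
        calc m x = m ![x 0, x 1] := by rw [site_two_eta]
          _ = m ![0, x 1] := hrows _ _
          _ = m ![0, 0] := hcyc _
          _ = m 0 := by rw [h00]
      obtain ⟨j₀, hj₀⟩ := hne
      have hz : (∏ j : ZMod L, (if m ![0, j] = m ![0, j - 1] then (1 : ℝ) else 0)) = 0 :=
        Finset.prod_eq_zero (Finset.mem_univ j₀) (by rw [if_neg hj₀])
      rw [hz, mul_zero]
  · -- some row is not constant: its factor vanishes identically
    push Not at hrows
    obtain ⟨j₀, hj₀⟩ := hrows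
    have hj₀' : ¬ ∀ i : ZMod L, m ![i, j₀] = m ![0, j₀] := by
      push Not
      exact hj₀
    have hconst : ¬ ∀ x, m x = m 0 := by
      intro hc
      obtain ⟨i, hi⟩ := hj₀
      exact hi ((hc _).trans (hc _).symm)
    rw [if_neg hconst]
    have hzero : ∀ h : Site 2 L → Matrix.specialUnitaryGroup (Fin 2) ℂ,
        (∏ j : ZMod L, if (∀ i : ZMod L, m ![i, j] = m ![0, j]) then
          (U ℝ (m ![0, j])).eval (su2a0 ((List.range L).map fun k : ℕ => h ![(k : ZMod L), j]).prod) *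
            (U ℝ (m ![0, j])).eval (su2a0 ((List.range L).map fun k : ℕ => h ![(k : ZMod L), j + 1]).prod) /
            ((m ![0, j] : ℝ) + 1) ^ L
          else 0) = 0 :=
      fun h => Finset.prod_eq_zero (Finset.mem_univ j₀) (by rw [if_neg hj₀'])
    simp_rw [hzero]
    exact integral_zero _ _

end Summit.Ventures.LatticeQCDFlow.Scoring
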